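import Summits.HodgeConjecture.HodgeConjecture.Theorems.PadicSemiregularLiftFormalLiftingFromClassLiftingHuReduction
import Literature.AlgebraicGeometry.KTheory.HuHypercohomologyDivisibility
import Literature.AlgebraicGeometry.Crystalline.DeRhamComplexTorsionFree
import Literature.AlgebraicGeometry.Crystalline.StaircaseIntegralDegeneration
import Literature.AlgebraicGeometry.Crystalline.HuComplexesHighWeight

/-!
# `FormalLiftingFromClassLifting` (stmt-HodgeConjecture-13825) · line `hu` · the crux from X. Hu's two named facts and three torsion-freeness statements on staircase hypercohomology

`…HuReduction.formalLiftingFromClassLifting_of_huFacts` closes crux P1a from X. Hu's two named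
facts (`KTheory.HuKZeroLiftingCriterion`, `KTheory.HuKZeroKernelPresentation`, arXiv:2507.12458)
and the two lattice lemmas (L1), (L2) on the hypercohomology of Hu's complexes. The Literature
chain `Crystalline/HuComplexes{Presentation,Truncated,Division}` +
`KTheory/HuHypercohomology{Criteria,Divisibility}` proves (L1) ∧ (L2)
(`KTheory.huLattice_of_torsionFree`) from the `p`-torsion-freeness of three families of
hypercohomology groups of the TRUNCATED STAIRCASE DE RHAM COMPLEXES
`σ≤(r-1) p^{(r-•)M}Ω•_{𝒳/W} = [p^{rM}𝒪 → p^{(r-1)M}Ω¹ → ⋯ → p^{M}Ω^{r-1}]`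
(`KTheory.staircaseH p k 𝒳 r M i`), whose columns are `Ωʲ_{𝒳/W}`, `j ≤ r - 1`:

* (a) `ℍ^{2r}(σ≤(r-1) p^{(r-•)(N+2)}Ω•)`, `1 ≤ r < d`, `N ≥ 0` (kernel side, low weights), plus
  (a') for `d ≤ r < p` the SURJECTIVITY of Hu's odd reductions `ℍ^{2r-1}(p^{r,1}_{r,N+3}) →
  ℍ^{2r-1}(p^{r,1}_{r,N+2})` (high weights: zero resp. top-degree groups by the support of Hu's
  complexes on the special fibre — `Crystalline/HuComplexesHighWeight`, not a torsion statement);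
* (b) `ℍ^{2r}(σ≤(r-1) p^{(r-•)}Ω•)`, `1 ≤ r < d` (obstruction side, the limit lattice);
* (c) `ℍ^{2r+1}(σ≤(r-1) p^{(r-•)(N+2)}Ω•)`, `1 ≤ r < d`, `N ≥ 0` (obstruction side, surjectivity).

This file performs that composition: `formalLiftingFromClassLifting_of_huFacts_of_torsionFree` —
the crux BY NAME from the two named facts and (a), (a'), (b), (c) quantified over the crux's data and
hypotheses (the `p`-torsion-freeness of the `Ωʲ` themselves being
`IsSmoothProperModel.mono_p_smul_id_algebraicDeRhamComplex_X`). On paper (a)–(c) follow from the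
crux's torsion-free Hodge cohomology `Hᵇ(𝒳, 𝒪)`, `Hᵇ(𝒳, Ω¹)` (+ `d ≤ 3 ∨ Ω¹` free) and the
degeneration of the Hodge–de Rham spectral sequence modulo torsion
(`Crystalline.HodgeDeRhamDegeneratesModTorsion`), by `Algebra/Homology/StupidFiltrationDegeneration`
along the staircase retraction; for `r ≥ d` on the kernel side by the support of Hu's complexes on
the special fibre (top-degree right exactness). CONDITIONAL on the two named facts.
`formalLiftingFromClassLifting_of_huFacts_of_hdeg_of_high` then DISCHARGES (a), (b), (c) from the third
named fact `Crystalline.HodgeDeRhamDegeneratesModTorsion` by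
`Crystalline.staircase_torsionFree_hyperExt_stupidTruncLE_weight` (`Crystalline/StaircaseIntegralDegeneration`):
the crux from THREE named facts and the high-weight surjectivity (a') alone; and
`formalLiftingFromClassLifting_of_huFacts_of_hdeg` supplies (a') from
`Crystalline.huHReduce_surjective_of_dim_le` (`Crystalline/HuComplexesHighWeight`): **the crux from
exactly the three named facts `HuKZeroLiftingCriterion`, `HuKZeroKernelPresentation`,
`HodgeDeRhamDegeneratesModTorsion`.** [folklore]
-/

set_option linter.dupNamespace false

namespace Summit.HodgeConjecture.HodgeConjecture.Theorems.FormalLiftingFromClassLifting.HuLine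

open CategoryTheory AlgebraicGeometry Limits
open Literature.AlgebraicGeometry Literature.AlgebraicGeometry.Motives
open Literature.AlgebraicGeometry.Motives.WittScheme
open Literature.AlgebraicGeometry.KTheory Literature.AlgebraicGeometry.KTheory.HuStaircase
open Literature.AlgebraicGeometry.Crystalline
open Summit.HodgeConjecture.HodgeConjecture.Theses.PadicSemiregularLift
open Literature.Algebra.Homology TopologicalSpace

noncomputable section

/-- **`FormalLiftingFromClassLifting` from X. Hu's two named facts and the torsion-freeness of the
staircase hypercohomology.** Granted `KTheory.HuKZeroLiftingCriterion` and
`KTheory.HuKZeroKernelPresentation` (claims of arXiv:2507.12458), the crux P1a holds as soon as, for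
every smooth proper model `𝒳/W(k)` in the crux's range, the groups
`ℍ^{2r}(|𝒳|, σ≤(r-1) p^{(r-•)(N+2)}Ω•)`, `ℍ^{2r}(|𝒳|, σ≤(r-1) p^{(r-•)}Ω•)` and
`ℍ^{2r+1}(|𝒳|, σ≤(r-1) p^{(r-•)(N+2)}Ω•)` (`1 ≤ r < d`) have no `p`-torsion (hypotheses `ha`, `hb`,
`hc`) and Hu's odd reductions are onto in the high weights `d ≤ r < p` (`ha'`), all quantified over
the crux's data: `KTheory.HuStaircase.huLattice_of_torsionFree_of_high` turns them into the lattice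
lemmas (L1), (L2), and `formalLiftingFromClassLifting_of_huFacts` concludes. [folklore] -/
theorem formalLiftingFromClassLifting_of_huFacts_of_torsionFree :
    HuKZeroLiftingCriterion → HuKZeroKernelPresentation →
    (∀ (p : ℕ) [Fact p.Prime] (k : Type) [Field k] [CharP k p] [PerfectRing k p] (d : ℕ)
      (𝒳 : SchemeOver (WittVector p k)),
      IsSmoothProperModel d 𝒳 → Crystalline.IsProjectiveOverRing 𝒳 → d + 6 < p →
      (∀ (b : ℕ) (x : structureSheafCohomology 𝒳.left b), (p : ℤ) • x = 0 → x = 0) →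
      (∀ (b : ℕ) (x : hodgeCohomologyOne 𝒳 b), (p : ℤ) • x = 0 → x = 0) →
      (d ≤ 3 ∨ Nonempty (cotangentSheaf 𝒳 ≅
        SheafOfModules.free (R := 𝒳.left.ringCatSheaf) (Fin d))) →
      ∀ (r : ℕ), 1 ≤ r → r < d → ∀ (N : ℕ) (x : staircaseH p k 𝒳 r (N + 2) (2 * (r : ℤ))),
        (p : ℤ) • x = 0 → x = 0) →
    (∀ (p : ℕ) [Fact p.Prime] (k : Type) [Field k] [CharP k p] [PerfectRing k p] (d : ℕ)
      (𝒳 : SchemeOver (WittVector p k)),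
      IsSmoothProperModel d 𝒳 → Crystalline.IsProjectiveOverRing 𝒳 → d + 6 < p →
      (∀ (b : ℕ) (x : structureSheafCohomology 𝒳.left b), (p : ℤ) • x = 0 → x = 0) →
      (∀ (b : ℕ) (x : hodgeCohomologyOne 𝒳 b), (p : ℤ) • x = 0 → x = 0) →
      (d ≤ 3 ∨ Nonempty (cotangentSheaf 𝒳 ≅
        SheafOfModules.free (R := 𝒳.left.ringCatSheaf) (Fin d))) →
      ∀ (r : ℕ), d ≤ r → r < p → ∀ N : ℕ,
        Function.Surjective (huHReduce p k 𝒳 r 1 (Nat.le_succ (N + 2)) (2 * (r : ℤ) - 1))) →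
    (∀ (p : ℕ) [Fact p.Prime] (k : Type) [Field k] [CharP k p] [PerfectRing k p] (d : ℕ)
      (𝒳 : SchemeOver (WittVector p k)),
      IsSmoothProperModel d 𝒳 → Crystalline.IsProjectiveOverRing 𝒳 → d + 6 < p →
      (∀ (b : ℕ) (x : structureSheafCohomology 𝒳.left b), (p : ℤ) • x = 0 → x = 0) →
      (∀ (b : ℕ) (x : hodgeCohomologyOne 𝒳 b), (p : ℤ) • x = 0 → x = 0) →
      (d ≤ 3 ∨ Nonempty (cotangentSheaf 𝒳 ≅
        SheafOfModules.free (R := 𝒳.left.ringCatSheaf) (Fin d))) →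
      ∀ (r : ℕ), 1 ≤ r → r < d → ∀ x : staircaseH p k 𝒳 r 1 (2 * (r : ℤ)),
        (p : ℤ) • x = 0 → x = 0) →
    (∀ (p : ℕ) [Fact p.Prime] (k : Type) [Field k] [CharP k p] [PerfectRing k p] (d : ℕ)
      (𝒳 : SchemeOver (WittVector p k)),
      IsSmoothProperModel d 𝒳 → Crystalline.IsProjectiveOverRing 𝒳 → d + 6 < p →
      (∀ (b : ℕ) (x : structureSheafCohomology 𝒳.left b), (p : ℤ) • x = 0 → x = 0) →
      (∀ (b : ℕ) (x : hodgeCohomologyOne 𝒳 b), (p : ℤ) • x = 0 → x = 0) →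
      (d ≤ 3 ∨ Nonempty (cotangentSheaf 𝒳 ≅
        SheafOfModules.free (R := 𝒳.left.ringCatSheaf) (Fin d))) →
      ∀ (r : ℕ), 1 ≤ r → r < d → ∀ (N : ℕ) (x : staircaseH p k 𝒳 r (N + 2) (2 * (r : ℤ) + 1)),
        (p : ℤ) • x = 0 → x = 0) →
    FormalLiftingFromClassLifting := by
  intro hOb hKer ha ha' hb hc
  refine formalLiftingFromClassLifting_of_huFacts hOb hKer ?_ ?_
  · intro p _ k _ _ _ d 𝒳 h𝒳 hproj hp hO hΩ hd
    haveI : ∀ j, Mono (((p : ℕ) : ℤ) • 𝟙 ((algebraicDeRhamComplex 𝒳).X j)) :=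
      h𝒳.mono_p_smul_id_algebraicDeRhamComplex_X 𝒳 d
    exact (huLattice_of_torsionFree_of_high p k 𝒳 d (ha p k d 𝒳 h𝒳 hproj hp hO hΩ hd)
      (ha' p k d 𝒳 h𝒳 hproj hp hO hΩ hd) (hb p k d 𝒳 h𝒳 hproj hp hO hΩ hd)
      (hc p k d 𝒳 h𝒳 hproj hp hO hΩ hd)).1
  · intro p _ k _ _ _ d 𝒳 h𝒳 hproj hp hO hΩ hd
    haveI : ∀ j, Mono (((p : ℕ) : ℤ) • 𝟙 ((algebraicDeRhamComplex 𝒳).X j)) :=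
      h𝒳.mono_p_smul_id_algebraicDeRhamComplex_X 𝒳 d
    exact (huLattice_of_torsionFree_of_high p k 𝒳 d (ha p k d 𝒳 h𝒳 hproj hp hO hΩ hd)
      (ha' p k d 𝒳 h𝒳 hproj hp hO hΩ hd) (hb p k d 𝒳 h𝒳 hproj hp hO hΩ hd)
      (hc p k d 𝒳 h𝒳 hproj hp hO hΩ hd)).2

/-- **`FormalLiftingFromClassLifting` from THREE named facts and the high-weight surjectivity.**
Granted X. Hu's `KTheory.HuKZeroLiftingCriterion` and `KTheory.HuKZeroKernelPresentation`
(arXiv:2507.12458) and Deligne's degeneration of the Hodge–de Rham spectral sequence modulo torsion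
(`Crystalline.HodgeDeRhamDegeneratesModTorsion`, Deligne 1968 Thm. 5.5 (ii)), the crux P1a holds as
soon as Hu's odd reductions `ℍ^{2r-1}(p^{r,1}_{r,N+3}Ω•) → ℍ^{2r-1}(p^{r,1}_{r,N+2}Ω•)` are onto in the
HIGH weights `d ≤ r < p` for the models in the crux's range (hypothesis `hhigh`; there the groups
vanish for `r > d` and the map is a top-degree one for `r = d`, by the support of Hu's complexes on
the special fibre — `Crystalline/HuComplexesHighWeight`): the torsion-freeness inputs (a), (b), (c)
of `formalLiftingFromClassLifting_of_huFacts_of_torsionFree` in the low weights `r < d` are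
`Crystalline.staircase_torsionFree_hyperExt_stupidTruncLE_weight` (integral `E₁`-degeneration of the
truncated staircase complexes from the named fact, the crux's torsion-free `Hᵇ(𝒳, 𝒪)`, `Hᵇ(𝒳, Ω¹)`
and `d ≤ 3 ∨ Ω¹` free). CONDITIONAL on the three named facts. [folklore] -/
theorem formalLiftingFromClassLifting_of_huFacts_of_hdeg_of_high :
    HuKZeroLiftingCriterion → HuKZeroKernelPresentation → HodgeDeRhamDegeneratesModTorsion →
    (∀ (p : ℕ) [Fact p.Prime] (k : Type) [Field k] [CharP k p] [PerfectRing k p] (d : ℕ)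
      (𝒳 : SchemeOver (WittVector p k)),
      IsSmoothProperModel d 𝒳 → Crystalline.IsProjectiveOverRing 𝒳 → d + 6 < p →
      (∀ (b : ℕ) (x : structureSheafCohomology 𝒳.left b), (p : ℤ) • x = 0 → x = 0) →
      (∀ (b : ℕ) (x : hodgeCohomologyOne 𝒳 b), (p : ℤ) • x = 0 → x = 0) →
      (d ≤ 3 ∨ Nonempty (cotangentSheaf 𝒳 ≅
        SheafOfModules.free (R := 𝒳.left.ringCatSheaf) (Fin d))) →
      ∀ (r : ℕ), d ≤ r → r < p → ∀ N : ℕ,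
        Function.Surjective (huHReduce p k 𝒳 r 1 (Nat.le_succ (N + 2)) (2 * (r : ℤ) - 1))) →
    FormalLiftingFromClassLifting := by
  intro hOb hKer hdeg hhigh
  refine formalLiftingFromClassLifting_of_huFacts_of_torsionFree hOb hKer ?_ hhigh ?_ ?_
  · intro p _ k _ _ _ d 𝒳 h𝒳 hproj hp hO hΩ hd r _ hrd N x hx
    have hA : ∀ (n : ℤ) (Y : Sheaf (Opens.grothendieckTopology 𝒳.left) AddCommGrpCat.{0}),
        HasHyperExt.{0} (constantSheafInt (Opens.grothendieckTopology 𝒳.left))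
          ((CochainComplex.singleFunctor _ n).obj Y) := fun n Y ↦
      HyperExt.hasHyperExt_singleFunctor_obj _ n Y
    exact staircase_torsionFree_hyperExt_stupidTruncLE_weight 𝒳 hdeg h𝒳 hO hΩ hd r (N + 2) hrd
      (2 * (r : ℤ)) (p : ℤ) (Int.natCast_ne_zero.mpr (Fact.out : p.Prime).ne_zero) x hx
  · intro p _ k _ _ _ d 𝒳 h𝒳 hproj hp hO hΩ hd r _ hrd x hx
    have hA : ∀ (n : ℤ) (Y : Sheaf (Opens.grothendieckTopology 𝒳.left) AddCommGrpCat.{0}),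
        HasHyperExt.{0} (constantSheafInt (Opens.grothendieckTopology 𝒳.left))
          ((CochainComplex.singleFunctor _ n).obj Y) := fun n Y ↦
      HyperExt.hasHyperExt_singleFunctor_obj _ n Y
    exact staircase_torsionFree_hyperExt_stupidTruncLE_weight 𝒳 hdeg h𝒳 hO hΩ hd r 1 hrd
      (2 * (r : ℤ)) (p : ℤ) (Int.natCast_ne_zero.mpr (Fact.out : p.Prime).ne_zero) x hx
  · intro p _ k _ _ _ d 𝒳 h𝒳 hproj hp hO hΩ hd r _ hrd N x hx
    have hA : ∀ (n : ℤ) (Y : Sheaf (Opens.grothendieckTopology 𝒳.left) AddCommGrpCat.{0}),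
        HasHyperExt.{0} (constantSheafInt (Opens.grothendieckTopology 𝒳.left))
          ((CochainComplex.singleFunctor _ n).obj Y) := fun n Y ↦
      HyperExt.hasHyperExt_singleFunctor_obj _ n Y
    exact staircase_torsionFree_hyperExt_stupidTruncLE_weight 𝒳 hdeg h𝒳 hO hΩ hd r (N + 2) hrd
      (2 * (r : ℤ) + 1) (p : ℤ) (Int.natCast_ne_zero.mpr (Fact.out : p.Prime).ne_zero) x hx

/-- **`FormalLiftingFromClassLifting` from exactly three named facts.** Granted X. Hu's
`KTheory.HuKZeroLiftingCriterion` and `KTheory.HuKZeroKernelPresentation` (arXiv:2507.12458, Thm. 1.2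
/ Prop. 11.1 (i) and Cor. 10.5 (i); claims of an unrefereed preprint) and Deligne's degeneration of
the Hodge–de Rham spectral sequence modulo torsion (`Crystalline.HodgeDeRhamDegeneratesModTorsion`,
Deligne 1968, Thm. 5.5 (ii)), the crux P1a `FormalLiftingFromClassLifting` of route
`HodgeConjecture/PadicSemiregularLift` HOLDS: the high-weight surjectivity (a') of
`formalLiftingFromClassLifting_of_huFacts_of_hdeg_of_high` is
`Crystalline.huHReduce_surjective_of_dim_le` (`Crystalline/HuComplexesHighWeight`: for `d ≤ r` the
groups `ℍ^{2r-1}(p^{r,1}_{r,n}Ω•)` sit at or above the top degree `(r - 1) + d` of a complex whose terms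
are supported on the special fibre, so the reductions are onto by termwise Grothendieck vanishing).
The whole `hu` line: Hu's facts ⇒ (glue + `K₀`-tower algebra, `…Glue`, `…HuTowerAlgebra`,
`…HuReduction`) the crux modulo the lattice lemmas (L1), (L2) ⇐ (`KTheory/HuHypercohomologyCriteria`,
`…Divisibility`, over `Crystalline/HuComplexes{Presentation,Truncated,Division}`) torsion-freeness of
`ℍ(σ≤(r-1) p^{(r-•)M}Ω•)` for `r < d` ⇐ (`Crystalline/StaircaseIntegralDegeneration`,
`Algebra/Homology/StupidFiltrationDegeneration`, `StaircaseRetraction`) the crux's torsion-free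
`Hᵇ(𝒳, 𝒪)`, `Hᵇ(𝒳, Ω¹)` + `d ≤ 3 ∨ Ω¹` free + Deligne's fact, and the weights `r ≥ d` by support.
CONDITIONAL on the three named facts; nothing else. [folklore] -/
theorem formalLiftingFromClassLifting_of_huFacts_of_hdeg :
    HuKZeroLiftingCriterion → HuKZeroKernelPresentation → HodgeDeRhamDegeneratesModTorsion →
    FormalLiftingFromClassLifting := by
  intro hOb hKer hdeg
  refine formalLiftingFromClassLifting_of_huFacts_of_hdeg_of_high hOb hKer hdeg ?_
  intro p _ k _ _ _ d 𝒳 h𝒳 _ _ _ _ _ r hdr _ N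
  exact huHReduce_surjective_of_dim_le h𝒳 hdr 1 (show 1 ≤ N + 2 by omega) (Nat.le_succ (N + 2))

end

end Summit.HodgeConjecture.HodgeConjecture.Theorems.FormalLiftingFromClassLifting.HuLine
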